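import Summits.QuantumFields.YangMills.Theorems.BalabanUVNodesPortS1LocalFormula
import Literature.MathematicalPhysics.QuantumFieldTheory.Balaban1983to89.B12Decay510Torus

/-!
# PORT PT-H, record side (helper; O-3 (a)) — THE SLOT-8 «RowG» ROW AT THE RECORD NAMES, part 1 (base lemmas): index-torus distance, the index diameter of a torus
# localization domain, the tiled range ∕ letter ∕ radius arithmetic at the names, and the two-modulus coordinate lemmas

Cell `ym-nodeO-ideate` ∕ `ym-balaban-port`, porter seat `ymgap-nodeO-port-PTC-1` (gen 2; slot-8 closer, now ORDER O-3: the JOIN consumer work on the K0ᴬ side, keyed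
`--supports stmt-QuantumFields-27238 --as helper`).  **The statements and proofs of this file and of part 2 (`…PortHRecordRowG`) are LANDED VERBATIM (sections §1 (idxDist part), §1b, §2
(arithmetic part), §8 of the HOME line file `nodeO-cover/LENS-1-Obligation1-GroupG-v1.3.lean` 4b94d93a503c9308) from the NODE-O cover's planner seat `ymgap-nodeO-lens-1` (g3∕g4), kernel-checked
there by CRIT-1 ∕ REF; credit theirs — this seat only re-homes them under a Theorems namespace so that the slot-8 JOIN can cite them BY NAME.**  [I] = [Balaban1987RG1].

WHAT IS HERE ([folklore] lattice bookkeeping about DEF-1's named geometry `recordSiteGeom ∕ recordRho ∕ recordE ∕ recordCc ∕ recordRNat`): §1 `min_val_sub`, `idxDist_triangle`,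
`natAbs_valMinAbs_le_idxDist_zero`; §1b `dist_le_len`, `idxDist_le_of_tAdmissible`, ★ `idxDist_le_torusTreeLen` (the index diameter of a torus localization domain is at most
`d·(d_j + 1)`, print p.257: `d_j(X)` = length of a shortest graph through the cubes of `X`); §2 `mc_pos`, `distD_recordE_zero` (the volume-step lemmas `PortU8.domCount_succ_vol` ∕ `BalabanUVNodesPortS1.domCount_le_succ` are the tree's, BY NAME),
`distC_recordE_zero`, `cubeDiam_at`, `le_domCount_div_two`, `twelve_mul_le_recordRNat`; §8 `natAbs_valMinAbs_intCast_le`, `intCast_mul_valMinAbs_eq`, `exists_val_div_eq_and_dist_le`,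
`dist_le_mul_idx_add` (site residues `ZMod (q·Mc)` versus cube indices `ZMod q`).
HONEST FRAMING.  Elementary geometry∕arithmetic at the names; nothing of Bałaban asserted, ported or discharged; the JOIN these rows feed routes displayed hypotheses (the OPEN port texts'
consequents) into K0ᴬ's stub and proves nothing of print either; finite `𝕋⁴_{L^K}` at fixed ε — NOT continuum ∕ OS ∕ Clay; **the Yang–Mills mass gap is NOT proved.**  No `def`,
`instance`, `sorry`; standard axioms.
-/

noncomputable section

open scoped BigOperators

namespace Summit.QuantumFields.YangMills.Theorems.PortHRecordRowG

open Literature.MathematicalPhysics.QuantumFieldTheory.Balaban1983to89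
open Literature.MathematicalPhysics.QuantumFieldTheory.Balaban1983to89.Node00
open Literature.MathematicalPhysics.QuantumFieldTheory.Balaban1983to89.T4Continuum (T4Family)
open Literature.MathematicalPhysics.QuantumFieldTheory.Balaban1983to89.TreeLengthTorus (TPt TAdj TStepIn TLinked TFaceConnected IsTDom TAdmissible
  torusTreeLen le_torusTreeLen exists_tAdmissible proj proj_apply)
open Literature.MathematicalPhysics.QuantumFieldTheory.Balaban1983to89.TreeLength (RPt Seg carrier len lenIn cube mem_cube len_nonneg
  sum_lenIn_le_len le_lenIn_closedBall)
open Summit.QuantumFields.YangMills.Theorems.K0RecordFormatNames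

/-! ## §1  Generic index-torus lemmas: the centred lift, off-seam adjacency, injectivity; `idxDist` -/

section Generic

variable {d q q' : ℕ}

/-- DEF-1's index distance term is `|valMinAbs|` of the difference. [folklore] -/
theorem min_val_sub [NeZero q] (x y : ZMod q) : min (x - y).val (y - x).val = (x - y).valMinAbs.natAbs := by
  rw [← neg_sub x y]
  generalize x - y = u
  rw [ZMod.valMinAbs_natAbs_eq_min, ZMod.neg_val]
  split_ifs with h
  · subst h; simp
  · rfl

/-- **Triangle inequality** for DEF-1's `idxDist`. [folklore] -/
theorem idxDist_triangle [NeZero q] (a b c : TPt d q) : idxDist a c ≤ idxDist a b + idxDist b c := by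
  unfold idxDist
  rw [← Finset.sum_add_distrib]
  refine Finset.sum_le_sum fun i _ => ?_
  rw [min_val_sub, min_val_sub, min_val_sub, show a i - c i = (a i - b i) + (b i - c i) by abel]
  exact (ZMod.natAbs_valMinAbs_add_le _ _).trans (Int.natAbs_add_le _ _)

/-- Each coordinate's `|valMinAbs|` is dominated by the index distance from `0`. [folklore] -/
theorem natAbs_valMinAbs_le_idxDist_zero [NeZero q] (c : TPt d q) (i : Fin d) : (c i).valMinAbs.natAbs ≤ idxDist 0 c := by
  unfold idxDist
  have h := Finset.single_le_sum (f := fun j => min ((0 : TPt d q) j - c j).val (c j - (0 : TPt d q) j).val) (fun _ _ => Nat.zero_le _)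
    (Finset.mem_univ i)
  refine le_trans (le_of_eq ?_) h
  show (c i).valMinAbs.natAbs = min ((0 : TPt d q) i - c i).val (c i - (0 : TPt d q) i).val
  rw [min_val_sub, Pi.zero_apply, zero_sub, ZMod.natAbs_valMinAbs_neg]

end Generic

/-! ## §1b  The index diameter of a torus localization domain is at most `d·(d_j + 1)` (print p.257: `d_j(X)` = length of a shortest graph through
the cubes of `X`; the tree's `TreeLengthTorus.torusTreeLen`, sup metric, unit cubes) -/

section Diameter

variable {d N : ℕ}

/-- Two points of a connected polygonal graph are at (sup-)distance at most its length (capture lemma `le_lenIn_closedBall` + additivity). [folklore] -/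
theorem dist_le_len {T : List (Seg d)} (hT : IsConnected (carrier T)) {p q : RPt d} (hp : p ∈ carrier T) (hq : q ∈ carrier T) :
    dist p q ≤ len T := by
  rcases (dist_nonneg : 0 ≤ dist p q).eq_or_lt with h | h
  · rw [← h]; exact len_nonneg T
  · have h1 := le_lenIn_closedBall hT.isPreconnected hp hq h le_rfl
    have h2 := sum_lenIn_le_len ({()} : Finset Unit) (fun _ => Metric.closedBall p (dist p q)) (fun _ _ => Metric.isClosed_closedBall)
      (by rw [Finset.coe_singleton]; exact Set.pairwiseDisjoint_singleton _ _) T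
    rw [Finset.sum_singleton] at h2
    exact h1.trans h2

/-- **Index distance vs. an admissible graph**: two cubes of a torus family met by an admissible graph `T` are at index distance `≤ d·(|T| + 1)`
(met lifts `x_a, x_b ∈ ℤᵈ`, points `p ∈ □(x_a)`, `q ∈ □(x_b)` on the connected graph: `|x_a,i − x_b,i| ≤ |p_i − q_i| + 1 ≤ |T| + 1`, and the torus
coordinate distance is at most that of any integer representative). [cite: Balaban1987RG1, p.257 (linear size d_j)] -/
theorem idxDist_le_of_tAdmissible [NeZero N] {X : Finset (TPt d N)} {T : List (Seg d)} (hT : TAdmissible X T) {a b : TPt d N}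
    (ha : a ∈ X) (hb : b ∈ X) : (idxDist a b : ℝ) ≤ d * (len T + 1) := by
  obtain ⟨xa, hxa, p, hpT, hpx⟩ := hT.meets a ha
  obtain ⟨xb, hxb, q, hqT, hqx⟩ := hT.meets b hb
  have hpq : dist p q ≤ len T := dist_le_len hT.connected hpT hqT
  rw [mem_cube] at hpx hqx
  have hterm : ∀ i, ((min (a i - b i).val (b i - a i).val : ℕ) : ℝ) ≤ len T + 1 := by
    intro i
    rw [min_val_sub]
    have h1 : (a i - b i).valMinAbs.natAbs ≤ (xa i - xb i).natAbs := by
      refine ZMod.natAbs_min_of_le_div_two N _ _ ?_ (ZMod.natAbs_valMinAbs_le _)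
      rw [ZMod.coe_valMinAbs, ← hxa, ← hxb]
      simp [proj_apply]
    have hd : |p i - q i| ≤ dist p q := by rw [← Real.dist_eq]; exact dist_le_pi_dist p q i
    have h2 : (((xa i - xb i).natAbs : ℕ) : ℝ) ≤ dist p q + 1 := by
      rw [← Int.cast_natCast (R := ℝ), Int.natCast_natAbs, Int.cast_abs, Int.cast_sub, abs_le]
      obtain ⟨hd1, hd2⟩ := abs_le.1 hd
      obtain ⟨hp1, hp2⟩ := hpx i
      obtain ⟨hq1, hq2⟩ := hqx i
      constructor <;> linarith
    calc (((a i - b i).valMinAbs.natAbs : ℕ) : ℝ) ≤ (((xa i - xb i).natAbs : ℕ) : ℝ) := by exact_mod_cast h1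
      _ ≤ len T + 1 := by linarith
  unfold idxDist
  rw [Nat.cast_sum]
  calc ∑ i, ((min (a i - b i).val (b i - a i).val : ℕ) : ℝ) ≤ ∑ _i : Fin d, (len T + 1) := Finset.sum_le_sum fun i _ => hterm i
    _ = d * (len T + 1) := by simp; ring

/-- **ROW (Diam), PROVED**: two cubes of a torus localization domain are at index distance `≤ d·(d_j + 1)`. [cite: Balaban1987RG1, p.257 (linear size d_j)] -/
theorem idxDist_le_torusTreeLen [NeZero N] {X : Finset (TPt d N)} (hX : IsTDom X) {a b : TPt d N} (ha : a ∈ X) (hb : b ∈ X) :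
    (idxDist a b : ℝ) ≤ d * (torusTreeLen X + 1) := by
  have hne : ∃ T, TAdmissible X T := (exists_tAdmissible hX.1 hX.2).imp fun T h => h.1
  rcases Nat.eq_zero_or_pos d with hd | hd
  · subst hd
    simp [idxDist]
  have hd' : (0 : ℝ) < d := by exact_mod_cast hd
  have key : (idxDist a b : ℝ) / d - 1 ≤ torusTreeLen X :=
    le_torusTreeLen hne fun T hT => by
      have := idxDist_le_of_tAdmissible hT ha hb
      rw [sub_le_iff_le_add, div_le_iff₀ hd']
      linarith
  rw [sub_le_iff_le_add, div_le_iff₀ hd'] at key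
  linarith

end Diameter

/-! ## §2  At the names: the tiled range, the letter, the radius -/

variable (F : T4Family)

variable {F} in
/-- An admissible letter is positive. [cite: Balaban1987RG1, p.257 (bookkeeping)] -/
theorem mc_pos {Mc : ℕ} (hMc : McGuard F Mc) : 0 < Mc := by
  obtain ⟨c, rfl⟩ := hMc
  exact pow_pos (by have := F.hL.2; omega) _

/-- `dist(e μ 0, X) = Mc · idxDist(0, nearest cube)`. [cite: Balaban1987RG1, p.257 (bookkeeping)] -/
theorem distD_recordE_zero (Mc k K : ℕ) (μ : Fin 4) (X : (recordDomSys F Mc k K).Dom) :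
    (recordSiteGeom F Mc k K).distD (recordE F k K μ 0) X = (Mc : ℝ) * (idxDist 0 (recordPick F Mc k K (recordE F k K μ 0) X) : ℝ) := by
  show recordDistC F Mc k K _ _ = _
  unfold recordDistC
  rw [cubeIdxOf_recordE_zero]

/-- `dist(e μ 0, □) = Mc · idxDist(0, □)`. [cite: Balaban1987RG1, p.257 (bookkeeping)] -/
theorem distC_recordE_zero (Mc k K : ℕ) (μ : Fin 4) (c : (recordCc F Mc k K).Cube) :
    recordDistC F Mc k K (recordE F k K μ 0) c = (Mc : ℝ) * (idxDist 0 c : ℝ) := by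
  unfold recordDistC
  rw [cubeIdxOf_recordE_zero]

/-- **ROW (Diam) AT THE NAMES, PROVED** (no residual): in site units, two cubes of a localization domain of `𝐃_{k+1}(T_K)` are at distance
`≤ 4·Mc·(d_j X + 1)`. [cite: Balaban1987RG1, p.257 (linear size d_j)] -/
theorem cubeDiam_at (Mc k K : ℕ) (X : (recordDomSys F Mc k K).Dom) {c c' : (recordCc F Mc k K).Cube} (hc : c ∈ (X.1 : Finset _))
    (hc' : c' ∈ (X.1 : Finset _)) : (Mc : ℝ) * (idxDist c c' : ℝ) ≤ 4 * Mc * (recordDomSys F Mc k K).dj X + 4 * Mc := by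
  have h := idxDist_le_torusTreeLen X.2 hc hc'
  have hMc : (0 : ℝ) ≤ Mc := Nat.cast_nonneg _
  have e : (recordDomSys F Mc k K).dj X = torusTreeLen X.1 := rfl
  have h4 : ((F.P K).d : ℝ) = 4 := by rw [T4Family.P_d]; norm_num
  rw [h4] at h
  rw [e]
  nlinarith [mul_le_mul_of_nonneg_left h hMc]

variable {F} in
/-- **The window is never small on the tiled range**: `L ≤ ⌊q_K ∕ 2⌋` (indeed `q_K = 2·L^{m+K−k−1−c} ≥ 2L`, `m ≥ 1`). [cite: Balaban1987RG1, (0.1) p.251, p.257] -/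
theorem le_domCount_div_two {Mc k K : ℕ} (hMc : McGuard F Mc) (hK : recordK₀ F Mc k ≤ K) : F.L ≤ Sect2.domCount (F.P K) Mc (k + 1) / 2 := by
  have h1 := domCount_mul_side_eq hMc hK
  obtain ⟨c, rfl⟩ := hMc
  have hL : 1 < F.L := F.hL.2
  have hlog : Nat.log F.L (F.L ^ c) = c := Nat.log_pow hL c
  simp only [recordK₀, hlog] at hK
  rw [T4Family.sitesPerDir_eq] at h1
  obtain ⟨r, hr⟩ : ∃ r, F.m + K = (k + 1 + c) + (r + 1) := ⟨F.m + K - (k + 1 + c) - 1, by have := F.hm; omega⟩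
  have hpos : 0 < F.L ^ (k + 1) * F.L ^ c := by positivity
  have e2 : 2 * F.L ^ (F.m + K) = 2 * (F.L ^ r * F.L) * (F.L ^ (k + 1) * F.L ^ c) := by rw [hr]; ring
  have hq : Sect2.domCount (F.P K) (F.L ^ c) (k + 1) = 2 * (F.L ^ r * F.L) :=
    Nat.eq_of_mul_eq_mul_right hpos (by rw [h1, e2])
  rw [hq, Nat.mul_div_cancel_left _ (by norm_num : 0 < 2)]
  exact Nat.le_mul_of_pos_left _ (by positivity)

variable {F} in
/-- `12·Mc ≤ recordRNat` on the tiled range (so `4·Mc ≤ (3∕4)·recordRNat`). [cite: Balaban1987RG1, (1.21) p.264 (bookkeeping)] -/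
theorem twelve_mul_le_recordRNat {Mc k K : ℕ} (hMc : McGuard F Mc) (hK : recordK₀ F Mc k ≤ K) : 12 * Mc ≤ recordRNat F Mc k K := by
  have h := le_domCount_div_two hMc hK
  have hL := F.hL11
  unfold recordRNat
  calc 12 * Mc = Mc * 12 := Nat.mul_comm _ _
    _ ≤ Mc * (Sect2.domCount (F.P K) Mc (k + 1) / 2) := Nat.mul_le_mul_left _ (by omega)


/-! ## §8  (v1.2) Generic two-modulus coordinate lemmas: site residues `ZMod (q·Mc)` versus cube indices `ZMod q` -/

open Literature.MathematicalPhysics.QuantumFieldTheory.Balaban1983to89.B3Taylor310LocalRemainder (tdist_eq_sum_natAbs tdist_comm tdist_triangle)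

section Coord

variable {N q Mc : ℕ} [NeZero N] [NeZero q]

/-- The torus coordinate distance of an integer shift is at most the shift. [folklore] -/
theorem natAbs_valMinAbs_intCast_le (m : ℤ) : ((m : ZMod N)).valMinAbs.natAbs ≤ m.natAbs :=
  ZMod.natAbs_min_of_le_div_two N _ _ (by rw [ZMod.coe_valMinAbs]) (ZMod.natAbs_valMinAbs_le _)

omit [NeZero N] [NeZero q] in
/-- Two-modulus congruence: `Mc · valMinAbs_q(x) ≡ Mc · x (mod q·Mc)`. [folklore] -/
theorem intCast_mul_valMinAbs_eq (hN : N = q * Mc) (x : ℤ) :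
    (((Mc : ℤ) * ((x : ZMod q)).valMinAbs : ℤ) : ZMod N) = (((Mc : ℤ) * x : ℤ) : ZMod N) := by
  rw [ZMod.intCast_eq_intCast_iff_dvd_sub]
  have hq : (q : ℤ) ∣ x - ((x : ZMod q)).valMinAbs := by
    rw [← ZMod.intCast_eq_intCast_iff_dvd_sub, ZMod.coe_valMinAbs]
  obtain ⟨j, hj⟩ := hq
  refine ⟨j, ?_⟩
  rw [hN, ← mul_sub, hj]
  push_cast
  ring

/-- **Reaching a prescribed cube**: from a site residue `u` one reaches SOME site of any cube index `t` within `Mc ×` the index-torus distance of the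
cube of `u` to `t` (shift by whole cubes, keep the offset inside the cube). [cite: Balaban1987RG1, p.257 (bookkeeping)] -/
theorem exists_val_div_eq_and_dist_le (hMc : 0 < Mc) (hN : N = q * Mc) (u : ZMod N) (t : ZMod q) :
    ∃ w : ZMod N, (((w.val / Mc : ℕ)) : ZMod q) = t ∧
      (u - w).valMinAbs.natAbs ≤ Mc * ((((u.val / Mc : ℕ)) : ZMod q) - t).valMinAbs.natAbs := by
  set a := u.val / Mc with ha
  set r := u.val % Mc with hr
  have hrlt : r < Mc := Nat.mod_lt _ hMc
  have htq : t.val < q := ZMod.val_lt t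
  have hlt : Mc * t.val + r < N := by
    rw [hN]
    calc Mc * t.val + r < Mc * t.val + Mc := by omega
      _ = Mc * (t.val + 1) := by ring
      _ ≤ Mc * q := Nat.mul_le_mul_left _ htq
      _ = q * Mc := Nat.mul_comm _ _
  refine ⟨((Mc * t.val + r : ℕ) : ZMod N), ?_, ?_⟩
  · rw [ZMod.val_natCast_of_lt hlt, show (Mc * t.val + r) / Mc = t.val by
      rw [Nat.mul_add_div hMc, Nat.div_eq_of_lt hrlt, Nat.add_zero]]
    exact ZMod.natCast_zmod_val t
  · have hu : u = ((Mc * a + r : ℕ) : ZMod N) := by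
      rw [show Mc * a + r = u.val from Nat.div_add_mod u.val Mc]
      exact (ZMod.natCast_zmod_val u).symm
    have hdiff : u - ((Mc * t.val + r : ℕ) : ZMod N) = (((Mc : ℤ) * ((a : ℤ) - (t.val : ℤ)) : ℤ) : ZMod N) := by
      rw [hu]; push_cast; ring
    have ht' : ((a : ZMod q) - t) = ((((a : ℤ) - (t.val : ℤ) : ℤ)) : ZMod q) := by
      push_cast; rw [ZMod.natCast_zmod_val]
    rw [ht']
    set δ' : ℤ := (((((a : ℤ) - (t.val : ℤ) : ℤ)) : ZMod q)).valMinAbs with hδ'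
    have hcast : (((u - ((Mc * t.val + r : ℕ) : ZMod N)).valMinAbs : ℤ) : ZMod N) = (((Mc : ℤ) * δ' : ℤ) : ZMod N) := by
      rw [ZMod.coe_valMinAbs, hdiff, hδ', intCast_mul_valMinAbs_eq hN]
    have h := ZMod.natAbs_min_of_le_div_two N _ _ hcast (ZMod.natAbs_valMinAbs_le _)
    rw [Int.natAbs_mul, Int.natAbs_natCast] at h
    exact h

omit [NeZero q] in
/-- **Diameter in site units**: two site residues are at torus distance `≤ Mc ×` the index distance of their cubes `+ (Mc − 1)` (written without
truncated subtraction). [cite: Balaban1987RG1, p.257 (bookkeeping)] -/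
theorem dist_le_mul_idx_add (hMc : 0 < Mc) (hN : N = q * Mc) (u w : ZMod N) :
    (u - w).valMinAbs.natAbs + 1 ≤ Mc * ((((u.val / Mc : ℕ)) : ZMod q) - (((w.val / Mc : ℕ)) : ZMod q)).valMinAbs.natAbs + Mc := by
  set a := u.val / Mc with ha
  set r := u.val % Mc with hr
  set a' := w.val / Mc with ha'
  set r' := w.val % Mc with hr'
  have hrlt : r < Mc := Nat.mod_lt _ hMc
  have hrlt' : r' < Mc := Nat.mod_lt _ hMc
  have hu : u = ((Mc * a + r : ℕ) : ZMod N) := by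
    rw [show Mc * a + r = u.val from Nat.div_add_mod u.val Mc]; exact (ZMod.natCast_zmod_val u).symm
  have hw : w = ((Mc * a' + r' : ℕ) : ZMod N) := by
    rw [show Mc * a' + r' = w.val from Nat.div_add_mod w.val Mc]; exact (ZMod.natCast_zmod_val w).symm
  have ht' : ((a : ZMod q) - (a' : ZMod q)) = ((((a : ℤ) - (a' : ℤ) : ℤ)) : ZMod q) := by push_cast; rfl
  rw [ht']
  set δ' : ℤ := (((((a : ℤ) - (a' : ℤ) : ℤ)) : ZMod q)).valMinAbs with hδ'
  have hdiff : u - w = (((Mc : ℤ) * ((a : ℤ) - (a' : ℤ)) + ((r : ℤ) - (r' : ℤ)) : ℤ) : ZMod N) := by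
    rw [hu, hw]; push_cast; ring
  have hc := intCast_mul_valMinAbs_eq (q := q) hN ((a : ℤ) - (a' : ℤ))
  rw [← hδ'] at hc
  have hcast : (((u - w).valMinAbs : ℤ) : ZMod N) = (((Mc : ℤ) * δ' + ((r : ℤ) - (r' : ℤ)) : ℤ) : ZMod N) := by
    rw [ZMod.coe_valMinAbs, hdiff, Int.cast_add, Int.cast_add, hc]
  have h := ZMod.natAbs_min_of_le_div_two N _ _ hcast (ZMod.natAbs_valMinAbs_le _)
  have h2 : ((Mc : ℤ) * δ' + ((r : ℤ) - (r' : ℤ))).natAbs ≤ Mc * δ'.natAbs + (Mc - 1) := by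
    refine (Int.natAbs_add_le _ _).trans ?_
    rw [Int.natAbs_mul, Int.natAbs_natCast]
    have : ((r : ℤ) - (r' : ℤ)).natAbs ≤ Mc - 1 := by omega
    omega
  omega

end Coord

end Summit.QuantumFields.YangMills.Theorems.PortHRecordRowG

end
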